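import Literature.Probability.Percolation.StraightCylinderCutsBounds
import HarnessLib

/-!
# Pinned min-cuts through straight cylinders: the seam and the inner walls are of lower order

Topic `Literature/Probability/Percolation`; companion of `StraightCylinderCuts.lean` /
`StraightCylinderCutsBounds.lean`. Counting estimates for the error terms of the gluing theorem and
of the quasi-monotonicity (Rossignol–Théret 2010, §4.1: the patching edges are "negligible compared
to `n^{d-1}`"):

* `card_cylSeamVertices_le` — `#{height-0 wall vertices of the tiling} ≤ 2 (d-1) · k · (k n)^{d-2}`
  (`= 2(d-1) k^{d-1} n^{d-2}`);
* `card_innerWallVertices_le` — `#{inner wall vertices} ≤ (d-1) · (2h+1) · n^{d-2}`.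

Both by embedding the sets into products of coordinate ranges (`Fintype.piFinset`).
-/

noncomputable section

namespace Literature.Probability.Percolation

open LatticeModels Finset

variable {d : ℕ} [NeZero d]

/-! ### Products over `Fin d` with two distinguished coordinates -/

omit [NeZero d] in
/-- `∏_{i'} f i' = f i₀ · f i₁ · ∏_{i' ≠ i₀, i₁} f i'` and the remaining factors are constant.
[folklore] -/
theorem prod_eq_of_two {M : Type*} [CommMonoid M] (f : Fin d → M) {i₀ i₁ : Fin d} (hne : i₁ ≠ i₀)
    (c : M) (hc : ∀ i', i' ≠ i₀ → i' ≠ i₁ → f i' = c) :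
    ∏ i', f i' = f i₀ * f i₁ * c ^ (d - 2) := by
  classical
  have h0 : i₀ ∈ (Finset.univ : Finset (Fin d)) := Finset.mem_univ _
  have h1 : i₁ ∈ (Finset.univ : Finset (Fin d)).erase i₀ := Finset.mem_erase.2 ⟨hne, Finset.mem_univ _⟩
  rw [← Finset.mul_prod_erase _ _ h0, ← Finset.mul_prod_erase _ _ h1, mul_assoc]
  congr 1
  congr 1
  rw [Finset.prod_congr rfl (fun i' hi' => hc i' (Finset.mem_erase.1 (Finset.mem_erase.1 hi').2).1
    (Finset.mem_erase.1 hi').1), Finset.prod_const]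
  congr 1
  rw [Finset.card_erase_of_mem h1, Finset.card_erase_of_mem h0, Finset.card_univ, Fintype.card_fin]
  omega

/-! ### The seam vertices -/

/-- **The seam is of lower order**: the height-`0` wall vertices of the tiling of the base of side
`k n` by blocks of side `n ≥ 1` number at most `2 (d-1) · k · (k n)^{d-2}`. [folklore] -/
theorem card_cylSeamVertices_le (a : Site d) {n : ℕ} (hn : 1 ≤ n) (k h : ℕ) :
    (cylSeamVertices a n k h).card ≤ 2 * (d - 1) * (k * (k * n) ^ (d - 2)) := by
  classical
  -- the product set of coordinate `i ≠ 0` and residue `ρ ∈ {0, n-1}`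
  set P : Finset (Fin d × ℤ) := (Finset.univ.erase 0) ×ˢ ({0, (n : ℤ) - 1} : Finset ℤ) with hP
  -- the coordinate ranges
  set t : Fin d × ℤ → Fin d → Finset ℤ := fun q i' =>
    if i' = 0 then {0} else if i' = q.1 then (Finset.range k).image (fun m : ℕ => a q.1 + n * m + q.2)
      else Finset.Ico (a i') (a i' + k * n) with ht
  have hsub : cylSeamVertices a n k h ⊆ P.biUnion fun q => Fintype.piFinset (t q) := by
    intro x hx
    rw [cylSeamVertices, Finset.mem_filter, Set.Finite.mem_toFinset] at hx
    obtain ⟨hxS, hx0, i, hi, hres⟩ := hx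
    rw [Finset.mem_biUnion]
    refine ⟨(i, (x i - a i) % n), ?_, ?_⟩
    · rw [hP, Finset.mem_product]
      refine ⟨Finset.mem_erase.2 ⟨hi, Finset.mem_univ _⟩, ?_⟩
      rcases hres with hres | hres <;> simp [hres]
    · rw [Fintype.mem_piFinset]
      intro i'
      simp only [ht]
      by_cases hi'0 : i' = 0
      · subst hi'0; simp [hx0]
      · rw [if_neg hi'0]
        by_cases hii : i' = i
        · subst hii
          rw [if_pos rfl, Finset.mem_image]
          obtain ⟨hq0, hqk⟩ := cylTileIdx_mem hn hxS i' hi'0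
          simp only [cylTileIdx, hi'0, if_false] at hq0 hqk
          refine ⟨((x i' - a i') / n).toNat, Finset.mem_range.2 (by omega), ?_⟩
          rw [Int.toNat_of_nonneg hq0]
          have := Int.emod_add_mul_ediv (x i' - a i') n
          linarith
        · rw [if_neg hii, Finset.mem_Ico]
          obtain ⟨h1, h2⟩ := hxS.2 i' hi'0
          exact ⟨h1, by push_cast at h2; linarith⟩
  have hcardP : P.card ≤ (d - 1) * 2 := by
    rw [hP, Finset.card_product, Finset.card_erase_of_mem (Finset.mem_univ _), Finset.card_univ,
      Fintype.card_fin]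
    exact Nat.mul_le_mul_left _ (Finset.card_insert_le _ _)
  have hpi : ∀ q ∈ P, (Fintype.piFinset (t q)).card ≤ k * (k * n) ^ (d - 2) := by
    intro q hq
    rw [hP, Finset.mem_product, Finset.mem_erase] at hq
    have hq0 : q.1 ≠ 0 := hq.1.1
    rw [Fintype.card_piFinset, prod_eq_of_two (fun i' => (t q i').card) hq0 (k * n) ?_]
    · have h0 : (t q 0).card = 1 := by simp [ht]
      have h1 : (t q q.1).card ≤ k := by
        simp only [ht, hq0, if_false, if_true]
        exact Finset.card_image_le.trans (Finset.card_range k).le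
      rw [h0, one_mul]
      exact Nat.mul_le_mul_right _ h1
    · intro i' hi'0 hi'q
      simp only [ht, if_neg hi'0, if_neg hi'q, Int.card_Ico, add_sub_cancel_left]
      exact_mod_cast Int.toNat_natCast (k * n)
  calc (cylSeamVertices a n k h).card ≤ (P.biUnion fun q => Fintype.piFinset (t q)).card :=
        Finset.card_le_card hsub
    _ ≤ ∑ q ∈ P, (Fintype.piFinset (t q)).card := Finset.card_biUnion_le
    _ ≤ ∑ _q ∈ P, k * (k * n) ^ (d - 2) := Finset.sum_le_sum hpi
    _ = P.card * (k * (k * n) ^ (d - 2)) := by rw [Finset.sum_const, smul_eq_mul]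
    _ ≤ (d - 1) * 2 * (k * (k * n) ^ (d - 2)) := Nat.mul_le_mul_right _ hcardP
    _ = 2 * (d - 1) * (k * (k * n) ^ (d - 2)) := by ring

/-! ### The inner wall vertices -/

/-- **The inner walls are of lower order**: the inner wall vertices of the cylinder of side `n` and
height `h` number at most `(d-1) · (2h+1) · n^{d-2}`. [folklore] -/
theorem card_innerWallVertices_le (a : Site d) (n h : ℕ) :
    (innerWallVertices a n h).card ≤ (d - 1) * ((2 * h + 1) * n ^ (d - 2)) := by
  classical
  set t : Fin d → Fin d → Finset ℤ := fun i i' =>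
    if i' = 0 then Finset.Icc (-(h : ℤ)) h else if i' = i then {a i + n - 1}
      else Finset.Ico (a i') (a i' + n) with ht
  have hsub : innerWallVertices a n h ⊆ (Finset.univ.erase 0).biUnion fun i => Fintype.piFinset (t i) := by
    intro x hx
    rw [innerWallVertices, Finset.mem_filter, Set.Finite.mem_toFinset] at hx
    obtain ⟨hxS, i, hi, hxi⟩ := hx
    rw [Finset.mem_biUnion]
    refine ⟨i, Finset.mem_erase.2 ⟨hi, Finset.mem_univ _⟩, ?_⟩
    rw [Fintype.mem_piFinset]
    intro i'
    simp only [ht]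
    by_cases hi'0 : i' = 0
    · subst hi'0
      rw [if_pos rfl, Finset.mem_Icc]
      exact abs_le.1 hxS.1
    · rw [if_neg hi'0]
      by_cases hii : i' = i
      · subst hii; rw [if_pos rfl, Finset.mem_singleton]; exact hxi
      · rw [if_neg hii, Finset.mem_Ico]; exact hxS.2 i' hi'0
  have hpi : ∀ i ∈ (Finset.univ : Finset (Fin d)).erase 0,
      (Fintype.piFinset (t i)).card = (2 * h + 1) * n ^ (d - 2) := by
    intro i hi
    have hi0 : i ≠ 0 := (Finset.mem_erase.1 hi).1
    rw [Fintype.card_piFinset, prod_eq_of_two (fun i' => (t i i').card) hi0 n ?_]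
    · have h0 : (t i 0).card = 2 * h + 1 := by
        simp only [ht, if_true, Int.card_Icc]
        omega
      have h1 : (t i i).card = 1 := by simp [ht, hi0]
      rw [h0, h1, mul_one]
    · intro i' hi'0 hi'q
      simp only [ht, if_neg hi'0, if_neg hi'q, Int.card_Ico, add_sub_cancel_left]
      exact Int.toNat_natCast n
  calc (innerWallVertices a n h).card
      ≤ ((Finset.univ.erase 0).biUnion fun i => Fintype.piFinset (t i)).card := Finset.card_le_card hsub
    _ ≤ ∑ i ∈ Finset.univ.erase 0, (Fintype.piFinset (t i)).card := Finset.card_biUnion_le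
    _ = ∑ _i ∈ (Finset.univ : Finset (Fin d)).erase 0, (2 * h + 1) * n ^ (d - 2) :=
        Finset.sum_congr rfl hpi
    _ = (d - 1) * ((2 * h + 1) * n ^ (d - 2)) := by
        rw [Finset.sum_const, smul_eq_mul, Finset.card_erase_of_mem (Finset.mem_univ _),
          Finset.card_univ, Fintype.card_fin]

end Literature.Probability.Percolation
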